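import Literature.MathematicalPhysics.QuantumFieldTheory.Balaban1983to89.B9Thm39CinvTorusRegularFinal
import Literature.MathematicalPhysics.QuantumFieldTheory.Balaban1983to89.B9Thm39CinvUpperLMember

/-!
# `Balaban1983to89.B9Thm39CinvOfEBlock` — [Balaban1985BackgroundPropagators] THEOREM 3.9 pp. 411–413 ⇒ THEOREM 3.2 (3.48) p. 398 FOR
# `C(U) = (Q′G′²Q′*)⁻¹(U)` AT def-Y's CARRIERS, FED WITH THEOREM 3.1's (3.42) BLOCKS OF `G′(U)` AND OF THE CUBE LETTERS `G′_□(U)` OVER THE INVARIANT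
# CLASS (M5.5's output `EBlock (kernelFamilySInv …)`) — the end-to-end statement of module M5.6: FILE 6 ∘ FILE 7 (cell `lit-balaban`, G-B9-LETTERS
# module M5.6 FILE 8, seat p21 gen 32)

statement-level skeleton of published theorems with citation tags; proofs where landed; nothing here is a claim about the Yang–Mills mass gap

CITATION HEADER (lean-in-tree rule).  B9 = T. Bałaban, *Propagators for lattice gauge theories in a background field*, Commun. Math. Phys. **99** (1985)
389–434 (journal page = PDF page + 388).  p. 397 Theorem 3.1 (3.42)₁ «|(G′(U)λ)(x)| ≦ B₀(Lʲη)²e^{−δ₀d(y,y′)}|λ|»; p. 398 Theorem 3.2 (3.48)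
«|(Q′(U)G′²(U)Q′*(U))⁻¹(y, y′)| ≦ B₀(Lʲη)⁻⁴(L^{j′}η)^{−d}e^{−δ₀d(y,y′)}»; p. 409 (3.87) «C₀ = Σ_{□∈𝒟} h_□C_□h_□», «The operators constructed for this
sequence, which we denote by G′_□(U), C_□(U) = (Q′(U)G′²_□(U)Q′*(U))⁻¹, G_□(U), satisfy all the inequalities of Theorems 3.1–3.3»; p. 411 (3.95)–(3.96)
«(Q′G′²Q′*)⁻¹ = C₀(I − R)⁻¹ = Σ C₀Rⁿ»; p. 413 Theorem 3.9 «For M sufficiently large … This theorem implies Theorem 3.2».  [4] = [Balaban1984PropagatorsII]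
Lemma 2.1 p. 234, (2.51)–(2.54) pp. 232–233, (2.83)–(2.87) pp. 237–238.  Rows B9.Thm3.9 × B9.Thm3.2 × B9.Thm3.1 × B9.Eq3.95 (cells only; no row head changes).

WHY THIS FILE.  FILE 6 (`B9Thm39CinvTorusRegularFinal.hasMajorant_conj_XinvY_final`) proves the (3.48)-shape majorant of `conj b (s•(Q′G′²Q′*)⁻¹(U))` from
per-cube data and two SITE majorants `hGG`, `hGGc` of `η⁴G′²`, `η⁴G′_□²`; FILE 7 (`B9Thm39CinvUpperLMember.hasMajorant_conj_GG_of_eBlockInv`) produces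
exactly those from Theorem 3.1's (3.42) blocks over the invariant class, `EBlock (kernelFamilySInv i B cfg G′ parS) B_G δ_G U₁` — the OUTPUT of M5.5
(`B9Thm37GpTorusRegularFinal.eBlock_kernelFamilySInv_Gp_of_localInverse`).  THIS FILE is their composition: ONE theorem taking M5.5's blocks for `G′` and for
every cube letter `G′_□`, at the weight `P = ℓ⁻⁴` of (3.48) and `κ_G = (M₂Σ_j‖b_j‖B_G)²·C_G·c₁((1−α_G)δ_G, α₂)`.

WHAT IS PROVED (two `theorem`s, 0 `def`, 0 sorry, 0 new named facts).
* ★★ `hasMajorant_conj_XinvY_of_eBlockInv` — for `U = cfg U₁`: `EBlock`s of `G′ = O` and of the `G′_□ = Oc □` (constants `B_G, δ_G`), a section `ιB` of `β`,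
  `IsUnit (XY i parS O U)`, contractive transporters, a coordinate bound `M₂` of `b`, the scale transfer of `ℓ²` at `α_G` and [4] Lemma 2.1 (2.61) at
  `((1−α_G)δ_G, α₂)` (FILE 7's geometry), a target rate `a_Lδ₀ ≦ (1−α₂)(1−α_G)δ_G`, and FILE 6's per-cube data VERBATIM at `P = ℓ⁻⁴`, `s′ = η²η²`
  (`s′s = 1`; cut-offs `h_□`, `χ_□`, supports `S_□ ⊃ supp h_□`, `S^χ_□`, overlap `N`, separation `D_sep`, slow variation `ℓ₀ + ℓ₁d`, local inverse property
  `hloc`, per-cube (3.48) blocks `hC` of the `C_□ = Cl □`, the [2]-difference majorants `hD` (GAP G-B9-05, weight `ℓ(a)⁴`), scale transfer of `ℓ⁻⁴` at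
  `α_st`, (2.54), reflexivity/symmetry/`d ≧ 0`, Lemma 2.1 at `(δ₀, b−ρ)` and (2.61)/(2.63) at `(ρδ₀, α′)`, exponent splits, the located smallness
  `(θ₁+θ₂+θ₃)c₁(ρδ₀, α′) < 1` with `θ₁, θ₂, θ₃` as in FILE 6 at `κ_G` above (equation hypotheses `hκG`, `hθ₁`, `hθ₂`, `hθ₃`)) ⟹
  `conj b (s•(XinvY i parS O U)) ≺ N·B₀·c₁(ρδ₀, α′)(1 − (θ₁+θ₂+θ₃)c₁)⁻¹·ℓ(a)⁻⁴·e^{−(1−α′)ρδ₀·d(a,a′)}` on def-Y's block carrier — (3.48)'s shape with every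
  constant explicit.
* ★★ `norm_XinvY_apply_of_eBlockInv` — (3.48)'s PRINTED SHAPE pointwise from the same data (`0 ≦ s`): for a source `λ` supported at one block `s₀` with
  `‖λ(s₀)‖ ≦ 1`, `s·‖((Q′G′²Q′*)⁻¹(U)λ)(t)‖ ≦ (Σ_j‖b_j‖)M₂·[N B₀c₁(1 − (θ₁+θ₂+θ₃)c₁)⁻¹]·ℓ(ιB t)⁻⁴·e^{−(1−α′)ρδ₀·d(ιB t, ιB s₀)}` (FILE 1's block reading
  `norm_apply_le_of_hasMajorant_blk` BY NAME) — «|(Q′G′²Q′*)⁻¹(y, y′)| ≦ B₀(Lʲη)⁻⁴…e^{−δ₀d(y,y′)}» with the constant and the rate explicit.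

HONEST SCOPE / NOT CLAIMED.  Pure composition of FILE 6 and FILE 7 (both landed shapes, USED BY NAME); exactly their scope: sup-entry (3.48) only; the
`EBlock`s (M5.5 — above ITS displayed inputs), the cube letters' `hC`/`hloc` (M5.2-E), `hD` (GAP G-B9-05 — NOT derived in the tree), `hLip` (GAPS G-pv08-1),
the cover's separation/overlap, the geometry and the smallness («M sufficiently large») are DISPLAYED hypotheses of the printed shape; corner-free members
(the section `ιB`); finite 𝕋 member of the k-level V1 family; nothing continuum, nothing about the mass gap; NOT summit progress.  RELATED, NOT DUPLICATED:
FILES 1–7 of the module; r06's scalar leaf glue `B9Thm39Whole.conv348_of_local348`; dag-n06-j/w1 `B9Thm32SiteCVariationalY` (variational road, cell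
pub-ymgap).  Searched 2026-08-28 `lean search 'XinvY_of_eBlock' --decl` = ∅.
-/

noncomputable section

namespace Literature.MathematicalPhysics.QuantumFieldTheory.Balaban1983to89.B9Thm39CinvOfEBlock

open Node00 B9CubeLettersInvReadings
open B6Geom246MultiLevelBox (blkOf)
open B6Ineq2142KLevelV1 (β)
open B6KLevelCensusIndexV1 (KIdx)
open B6RandomWalk (HasMajorant Triangle254 Ineq261 Ineq263 hasMajorant_mono)
open B9Thm34Ext (toB6)
open B9FromB6 (EBlock)
open B9GeoNormsKLevelV1 (geo9K)
open B9Eq352DivFormLetters (conj)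
open B9Thm37CubeCoverCommutators (cutMulY)
open B9Thm39CinvTorusRegular (norm_apply_le_of_hasMajorant_blk)
open B9Thm39CinvTorusRegularFinal (hasMajorant_conj_XinvY_final)
open B9Thm39CinvUpperLMember (hasMajorant_conj_GG_of_eBlockInv)

variable {d ℓ : ℕ} {hd : 1 ≤ d + 1} {hL : Odd (ℓ + 1) ∧ 1 < ℓ + 1} {b₀ b₁ : ℝ}
variable {𝔸 : Type} [NormedRing 𝔸] [NormedAlgebra ℂ 𝔸] [CompleteSpace 𝔸]
variable {ι : Type} [Fintype ι] [DecidableEq ι]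
variable (i : KIdx d ℓ hd hL b₀ b₁) (b : Module.Basis ι ℝ 𝔸)
variable [Fintype (geo9K i).Site] [DecidableEq (geo9K i).Site] {Rr : ℝ} {Hp : Prop}
variable {B : B9.Backgrounds} (cfg : B.Cfg → CfgY 𝔸 i) (O : SiteOpY 𝔸 i) (parS : SiteParY 𝔸 i) {U₁ : B.Cfg}

/-- ★★ **THEOREM 3.9 ⇒ THEOREM 3.2 (3.48) FOR `C(U) = (Q′G′²Q′*)⁻¹(U)` FROM THEOREM 3.1's (3.42) BLOCKS OF `G′(U)` AND OF THE CUBE LETTERS `G′_□(U)`**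
(M5.6 end-to-end at def-Y's carriers; FILE 6 `hasMajorant_conj_XinvY_final` with its site majorants `hGG`/`hGGc` DISCHARGED by FILE 7 from
`EBlock (kernelFamilySInv i B cfg G′ parS) B_G δ_G U₁` and the `EBlock`s of the `G′_□`, at `P = ℓ⁻⁴`, `s′ = η²η²`,
`κ_G = (M₂Σ_j‖b_j‖B_G)²C_Gc₁((1−α_G)δ_G, α₂)`): under FILE 6's per-cube displayed data and located smallness,
`conj b (s•(Q′G′²Q′*)⁻¹(U)) ≺ N·B₀·c₁(ρδ₀,α′)·(1 − (θ₁+θ₂+θ₃)c₁(ρδ₀,α′))⁻¹·ℓ(a)⁻⁴·e^{−(1−α′)ρδ₀d(a,a′)}` on the block carrier `(t, j) ↦ ιB t`.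
[cite: Balaban1985BackgroundPropagators, Thm 3.9 p.413 + (3.95)–(3.96) p.411 + (3.87) p.409 + Thm 3.1 (3.42) p.397 + Thm 3.2 (3.48) p.398;
Balaban1984PropagatorsII, Lemma 2.1 p.234 + (2.83)–(2.85) p.237] -/
theorem hasMajorant_conj_XinvY_of_eBlockInv {κι : Type} [Fintype κι] (Oc : κι → SiteOpY 𝔸 i)
    {BG δG : ℝ} (hE : EBlock (kernelFamilySInv i B cfg O parS) BG δG U₁) (hEc : ∀ k, EBlock (kernelFamilySInv i B cfg (Oc k) parS) BG δG U₁)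
    (hBG : 0 ≤ BG) (ιB : BlkY i → IBondY i) (hι : ∀ s, β i.hN i.D i.hk (ιB s) = s)
    (hunit : IsUnit (XY i parS O (cfg U₁)))
    (hpar : ∀ z w : SiteY i, ‖(parS (cfg U₁) z w : 𝔸)‖ ≤ 1 ∧ ‖(((parS (cfg U₁) z w)⁻¹ : 𝔸ˣ) : 𝔸)‖ ≤ 1)
    {M₂ : ℝ} (hM₂ : 0 ≤ M₂) (hrepr : ∀ (v : 𝔸) (j : ι), |b.repr v j| ≤ M₂ * ‖v‖) (d' d₂ : ℕ)
    {αG α₂ CG : ℝ} (hCG : 0 ≤ CG) (hαGδ : 0 ≤ αG * δG) (hα₂0 : 0 ≤ α₂) (hα₂1 : α₂ ≤ 1) (hδG : 0 ≤ (1 - αG) * δG)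
    (hSTG : B9Ineq347.ScaleTransfer (geo9K i) δG αG CG (fun a => (geo9K i).len a ^ 2))
    (h261G : Ineq261 d₂ (toB6 (geo9K i) Rr Hp) ((1 - αG) * δG) α₂)
    {δ₀ aL aD αc αst asep ρ bb κG κD Dsep ℓ₀ ℓ₁ B₀ C N s α' θ₁ θ₂ θ₃ : ℝ} (hrate : aL * δ₀ ≤ (1 - α₂) * ((1 - αG) * δG))
    (Sχ S : κι → Finset (geo9K i).Site) (χ h : κι → BlkY i → ℝ) (Cl : κι → Module.End ℝ (BlkY i → 𝔸))
    (hs : (etaS i ^ 2 * etaS i ^ 2) * s = 1) (hκD : 0 ≤ κD) (hℓ₀ : 0 ≤ ℓ₀) (hℓ₁ : 0 ≤ ℓ₁) (hB₀ : 0 ≤ B₀) (hC0 : 0 ≤ C) (hN : 0 ≤ N)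
    (hδ₀ : 0 ≤ δ₀) (hasep : 0 ≤ asep) (hρ : 0 ≤ ρ) (hρb : ρ ≤ bb) (hαc : 0 < αc * δ₀) (hα'1 : α' ≤ 1)
    (hsplit₁ : αst + asep + ρ ≤ aL) (hsplit₂ : αst + ρ ≤ aD) (hsplit₃ : αst + αc + ρ ≤ aL)
    (hκG : κG = (M₂ * (∑ j, ‖b j‖) * BG) ^ 2 * CG * B6.c1 d₂ ((1 - αG) * δG) α₂)
    (hθ₁ : θ₁ = N * (((M₂ * ∑ j, ‖b j‖) ^ 2 * κG) * B₀ * C * B6.c1 d' δ₀ (bb - ρ) * Real.exp (-(asep * δ₀ * Dsep))))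
    (hθ₂ : θ₂ = N * (κD * Real.exp (-(2 * δ₀ * Dsep)) * B₀ * C * B6.c1 d' δ₀ (bb - ρ)))
    (hθ₃ : θ₃ = N * ((ℓ₀ + ℓ₁ * (αc * δ₀)⁻¹) * ((M₂ * ∑ j, ‖b j‖) ^ 2 * κG) * B₀ * C * B6.c1 d' δ₀ (bb - ρ)))
    (htri : Triangle254 (toB6 (geo9K i) Rr Hp)) (hrefl : ∀ y : (geo9K i).Site, (geo9K i).dist y y = 0)
    (hsymm : ∀ a a' : (geo9K i).Site, (geo9K i).dist a a' = (geo9K i).dist a' a) (hdnn : ∀ a a' : (geo9K i).Site, 0 ≤ (geo9K i).dist a a')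
    (hST : B9Ineq347.ScaleTransfer (geo9K i) δ₀ αst C (fun a => ((geo9K i).len a ^ 4)⁻¹)) (h261b : Ineq261 d' (toB6 (geo9K i) Rr Hp) δ₀ (bb - ρ))
    (h261 : Ineq261 d' (toB6 (geo9K i) Rr Hp) (ρ * δ₀) α') (h263 : Ineq263 d' (toB6 (geo9K i) Rr Hp) (ρ * δ₀) α')
    (hsmall : (θ₁ + θ₂ + θ₃) * B6.c1 d' (ρ * δ₀) α' < 1)
    (hsq : ∀ t, ∑ k, h k t ^ 2 = 1) (hh : ∀ k t, |h k t| ≤ 1) (hS : ∀ k t, h k t ≠ 0 → ιB t ∈ S k)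
    (hcnt : ∀ a : (geo9K i).Site, (∑ k, if a ∈ S k then (1 : ℝ) else 0) ≤ N)
    (hχ01 : ∀ k t, 0 ≤ χ k t ∧ χ k t ≤ 1) (hχS : ∀ k t, ιB t ∈ Sχ k → χ k t = 1)
    (hsep : ∀ k a, a ∉ Sχ k → ∀ a'' ∈ S k, Dsep ≤ (geo9K i).dist a a'')
    (hLip : ∀ k (t t' : BlkY i), |h k t' - h k t| ≤ ℓ₀ + ℓ₁ * (geo9K i).dist (ιB t) (ιB t'))
    (hloc : ∀ k, (cutMulY (𝔸 := 𝔸) (h k)).restrictScalars ℝ *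
      ((cutMulY (𝔸 := 𝔸) (χ k)).restrictScalars ℝ * (XY i parS (Oc k) (cfg U₁)).restrictScalars ℝ) * Cl k * (cutMulY (𝔸 := 𝔸) (h k)).restrictScalars ℝ =
      (cutMulY (𝔸 := 𝔸) (h k)).restrictScalars ℝ * (cutMulY (𝔸 := 𝔸) (h k)).restrictScalars ℝ)
    (hC : ∀ k, HasMajorant (g := toB6 (geo9K i) Rr Hp) (fun p : BlkY i × ι => ιB p.1) (conj b (s • Cl k))
      (fun a a' => if a ∈ S k then B₀ * ((geo9K i).len a ^ 4)⁻¹ * Real.exp (-(bb * δ₀ * (geo9K i).dist a a')) else 0))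
    (hD : ∀ k, HasMajorant (g := toB6 (geo9K i) Rr Hp) (fun p : BlkY i × ι => ιB p.1)
      (conj b ((etaS i ^ 2 * etaS i ^ 2) • ((XY i parS O (cfg U₁)).restrictScalars ℝ - (XY i parS (Oc k) (cfg U₁)).restrictScalars ℝ)))
      (fun a a'' => κD * Real.exp (-(2 * δ₀ * Dsep)) * (geo9K i).len a ^ 4 * Real.exp (-(aD * δ₀ * (geo9K i).dist a a'')))) :
    HasMajorant (g := toB6 (geo9K i) Rr Hp) (fun p : BlkY i × ι => ιB p.1) (conj b (s • (XinvY i parS O (cfg U₁)).restrictScalars ℝ))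
      (fun a a' => N * B₀ * B6.c1 d' (ρ * δ₀) α' * (1 - (θ₁ + θ₂ + θ₃) * B6.c1 d' (ρ * δ₀) α')⁻¹ * ((geo9K i).len a ^ 4)⁻¹ *
        Real.exp (-((1 - α') * (ρ * δ₀) * (geo9K i).dist a a'))) := by
  subst hκG
  have hP : ∀ a : (geo9K i).Site, 0 < ((geo9K i).len a ^ 4)⁻¹ := fun a => inv_pos.mpr (pow_pos (B6KLevelCensusIndexV1.len_pos i a) 4)
  -- the [2]-difference majorants at FILE 6's weight `(P a)⁻¹ = ((ℓ⁴)⁻¹)⁻¹`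
  have hD' : ∀ k, HasMajorant (g := toB6 (geo9K i) Rr Hp) (fun p : BlkY i × ι => ιB p.1)
      (conj b ((etaS i ^ 2 * etaS i ^ 2) • ((XY i parS O (cfg U₁)).restrictScalars ℝ - (XY i parS (Oc k) (cfg U₁)).restrictScalars ℝ)))
      (fun a a'' => κD * Real.exp (-(2 * δ₀ * Dsep)) * (((geo9K i).len a ^ 4)⁻¹)⁻¹ * Real.exp (-(aD * δ₀ * (geo9K i).dist a a''))) := fun k =>
    hasMajorant_mono (g := toB6 (geo9K i) Rr Hp) _ (hD k) fun a a'' => le_of_eq (by rw [inv_inv])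
  -- FILE 6 fed with FILE 7's site majorants of `η⁴G′²` and `η⁴G′_□²`
  exact hasMajorant_conj_XinvY_final i b ιB parS O (cfg U₁) hunit hpar hM₂ hrepr d' (fun a => ((geo9K i).len a ^ 4)⁻¹) Sχ S χ h Oc Cl hs
    (mul_nonneg (mul_nonneg (sq_nonneg _) hCG) (B6RandomWalk.c1_nonneg d₂ _ _)) hκD hℓ₀ hℓ₁ hB₀ hC0 hN hP hδ₀ hasep hρ hρb hαc hα'1
    hsplit₁ hsplit₂ hsplit₃ hθ₁ hθ₂ hθ₃ htri hrefl hsymm hdnn hST h261b h261 h263 hsmall hsq hh hS hcnt hχ01 hχS hsep hLip hloc hC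
    (hasMajorant_conj_GG_of_eBlockInv i b cfg O parS hE hBG ιB hι hM₂ hrepr d₂ hCG hαGδ hα₂0 hα₂1 hδG htri hdnn hSTG h261G hrate)
    (fun k => hasMajorant_conj_GG_of_eBlockInv i b cfg (Oc k) parS (hEc k) hBG ιB hι hM₂ hrepr d₂ hCG hαGδ hα₂0 hα₂1 hδG htri hdnn hSTG h261G hrate)
    hD'

/-- ★★ **THEOREM 3.2 (3.48) FOR `C(U) = (Q′G′²Q′*)⁻¹(U)` POINTWISE, FROM THEOREM 3.1's (3.42) BLOCKS OF `G′(U)`, `G′_□(U)`** («|(Q′(U)G′²(U)Q′*(U))⁻¹(y, y′)| ≦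
B₀(Lʲη)⁻⁴(L^{j′}η)^{−d}e^{−δ₀d(y,y′)}», constant and rate explicit): under the hypotheses of `hasMajorant_conj_XinvY_of_eBlockInv` and `0 ≦ s`, every source `λ`
supported at one block `s₀` with `‖λ(s₀)‖ ≦ 1` obeys
`s·‖(XinvY i parS O U λ)(t)‖ ≦ (Σ_j‖b_j‖)M₂·[N B₀c₁(ρδ₀,α′)(1 − (θ₁+θ₂+θ₃)c₁(ρδ₀,α′))⁻¹]·ℓ(ιB t)⁻⁴·e^{−(1−α′)ρδ₀·d(ιB t, ιB s₀)}` (FILE 1's block reading BY NAME).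
[cite: Balaban1985BackgroundPropagators, Thm 3.2 (3.48) p.398 via Thm 3.9 p.413 + Thm 3.1 (3.42) p.397; Balaban1984PropagatorsII, (2.51) p.232] -/
theorem norm_XinvY_apply_of_eBlockInv {κι : Type} [Fintype κι] (Oc : κι → SiteOpY 𝔸 i)
    {BG δG : ℝ} (hE : EBlock (kernelFamilySInv i B cfg O parS) BG δG U₁) (hEc : ∀ k, EBlock (kernelFamilySInv i B cfg (Oc k) parS) BG δG U₁)
    (hBG : 0 ≤ BG) (ιB : BlkY i → IBondY i) (hι : ∀ s, β i.hN i.D i.hk (ιB s) = s)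
    (hunit : IsUnit (XY i parS O (cfg U₁)))
    (hpar : ∀ z w : SiteY i, ‖(parS (cfg U₁) z w : 𝔸)‖ ≤ 1 ∧ ‖(((parS (cfg U₁) z w)⁻¹ : 𝔸ˣ) : 𝔸)‖ ≤ 1)
    {M₂ : ℝ} (hM₂ : 0 ≤ M₂) (hrepr : ∀ (v : 𝔸) (j : ι), |b.repr v j| ≤ M₂ * ‖v‖) (d' d₂ : ℕ)
    {αG α₂ CG : ℝ} (hCG : 0 ≤ CG) (hαGδ : 0 ≤ αG * δG) (hα₂0 : 0 ≤ α₂) (hα₂1 : α₂ ≤ 1) (hδG : 0 ≤ (1 - αG) * δG)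
    (hSTG : B9Ineq347.ScaleTransfer (geo9K i) δG αG CG (fun a => (geo9K i).len a ^ 2))
    (h261G : Ineq261 d₂ (toB6 (geo9K i) Rr Hp) ((1 - αG) * δG) α₂)
    {δ₀ aL aD αc αst asep ρ bb κG κD Dsep ℓ₀ ℓ₁ B₀ C N s α' θ₁ θ₂ θ₃ : ℝ} (hrate : aL * δ₀ ≤ (1 - α₂) * ((1 - αG) * δG))
    (Sχ S : κι → Finset (geo9K i).Site) (χ h : κι → BlkY i → ℝ) (Cl : κι → Module.End ℝ (BlkY i → 𝔸))
    (hs : (etaS i ^ 2 * etaS i ^ 2) * s = 1) (hs0 : 0 ≤ s) (hκD : 0 ≤ κD) (hℓ₀ : 0 ≤ ℓ₀) (hℓ₁ : 0 ≤ ℓ₁) (hB₀ : 0 ≤ B₀) (hC0 : 0 ≤ C) (hN : 0 ≤ N)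
    (hδ₀ : 0 ≤ δ₀) (hasep : 0 ≤ asep) (hρ : 0 ≤ ρ) (hρb : ρ ≤ bb) (hαc : 0 < αc * δ₀) (hα'1 : α' ≤ 1)
    (hsplit₁ : αst + asep + ρ ≤ aL) (hsplit₂ : αst + ρ ≤ aD) (hsplit₃ : αst + αc + ρ ≤ aL)
    (hκG : κG = (M₂ * (∑ j, ‖b j‖) * BG) ^ 2 * CG * B6.c1 d₂ ((1 - αG) * δG) α₂)
    (hθ₁ : θ₁ = N * (((M₂ * ∑ j, ‖b j‖) ^ 2 * κG) * B₀ * C * B6.c1 d' δ₀ (bb - ρ) * Real.exp (-(asep * δ₀ * Dsep))))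
    (hθ₂ : θ₂ = N * (κD * Real.exp (-(2 * δ₀ * Dsep)) * B₀ * C * B6.c1 d' δ₀ (bb - ρ)))
    (hθ₃ : θ₃ = N * ((ℓ₀ + ℓ₁ * (αc * δ₀)⁻¹) * ((M₂ * ∑ j, ‖b j‖) ^ 2 * κG) * B₀ * C * B6.c1 d' δ₀ (bb - ρ)))
    (htri : Triangle254 (toB6 (geo9K i) Rr Hp)) (hrefl : ∀ y : (geo9K i).Site, (geo9K i).dist y y = 0)
    (hsymm : ∀ a a' : (geo9K i).Site, (geo9K i).dist a a' = (geo9K i).dist a' a) (hdnn : ∀ a a' : (geo9K i).Site, 0 ≤ (geo9K i).dist a a')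
    (hST : B9Ineq347.ScaleTransfer (geo9K i) δ₀ αst C (fun a => ((geo9K i).len a ^ 4)⁻¹)) (h261b : Ineq261 d' (toB6 (geo9K i) Rr Hp) δ₀ (bb - ρ))
    (h261 : Ineq261 d' (toB6 (geo9K i) Rr Hp) (ρ * δ₀) α') (h263 : Ineq263 d' (toB6 (geo9K i) Rr Hp) (ρ * δ₀) α')
    (hsmall : (θ₁ + θ₂ + θ₃) * B6.c1 d' (ρ * δ₀) α' < 1)
    (hsq : ∀ t, ∑ k, h k t ^ 2 = 1) (hh : ∀ k t, |h k t| ≤ 1) (hS : ∀ k t, h k t ≠ 0 → ιB t ∈ S k)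
    (hcnt : ∀ a : (geo9K i).Site, (∑ k, if a ∈ S k then (1 : ℝ) else 0) ≤ N)
    (hχ01 : ∀ k t, 0 ≤ χ k t ∧ χ k t ≤ 1) (hχS : ∀ k t, ιB t ∈ Sχ k → χ k t = 1)
    (hsep : ∀ k a, a ∉ Sχ k → ∀ a'' ∈ S k, Dsep ≤ (geo9K i).dist a a'')
    (hLip : ∀ k (t t' : BlkY i), |h k t' - h k t| ≤ ℓ₀ + ℓ₁ * (geo9K i).dist (ιB t) (ιB t'))
    (hloc : ∀ k, (cutMulY (𝔸 := 𝔸) (h k)).restrictScalars ℝ *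
      ((cutMulY (𝔸 := 𝔸) (χ k)).restrictScalars ℝ * (XY i parS (Oc k) (cfg U₁)).restrictScalars ℝ) * Cl k * (cutMulY (𝔸 := 𝔸) (h k)).restrictScalars ℝ =
      (cutMulY (𝔸 := 𝔸) (h k)).restrictScalars ℝ * (cutMulY (𝔸 := 𝔸) (h k)).restrictScalars ℝ)
    (hC : ∀ k, HasMajorant (g := toB6 (geo9K i) Rr Hp) (fun p : BlkY i × ι => ιB p.1) (conj b (s • Cl k))
      (fun a a' => if a ∈ S k then B₀ * ((geo9K i).len a ^ 4)⁻¹ * Real.exp (-(bb * δ₀ * (geo9K i).dist a a')) else 0))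
    (hD : ∀ k, HasMajorant (g := toB6 (geo9K i) Rr Hp) (fun p : BlkY i × ι => ιB p.1)
      (conj b ((etaS i ^ 2 * etaS i ^ 2) • ((XY i parS O (cfg U₁)).restrictScalars ℝ - (XY i parS (Oc k) (cfg U₁)).restrictScalars ℝ)))
      (fun a a'' => κD * Real.exp (-(2 * δ₀ * Dsep)) * (geo9K i).len a ^ 4 * Real.exp (-(aD * δ₀ * (geo9K i).dist a a''))))
    (lam : BlkY i → 𝔸) (s₀ : BlkY i) (hsupp : ∀ t, t ≠ s₀ → lam t = 0) (hbd : ‖lam s₀‖ ≤ 1) (t : BlkY i) :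
    s * ‖XinvY i parS O (cfg U₁) lam t‖ ≤ (∑ j, ‖b j‖) * M₂ * (N * B₀ * B6.c1 d' (ρ * δ₀) α' * (1 - (θ₁ + θ₂ + θ₃) * B6.c1 d' (ρ * δ₀) α')⁻¹) *
      ((geo9K i).len (ιB t) ^ 4)⁻¹ * Real.exp (-((1 - α') * (ρ * δ₀) * (geo9K i).dist (ιB t) (ιB s₀))) := by
  have hmaj := hasMajorant_conj_XinvY_of_eBlockInv i b cfg O parS (Rr := Rr) (Hp := Hp) Oc hE hEc hBG ιB hι hunit hpar hM₂ hrepr d' d₂ hCG hαGδ hα₂0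
    hα₂1 hδG hSTG h261G hrate Sχ S χ h Cl hs hκD hℓ₀ hℓ₁ hB₀ hC0 hN hδ₀ hasep hρ hρb hαc hα'1 hsplit₁ hsplit₂ hsplit₃ hκG hθ₁ hθ₂ hθ₃ htri hrefl hsymm
    hdnn hST h261b h261 h263 hsmall hsq hh hS hcnt hχ01 hχS hsep hLip hloc hC hD
  have hw := norm_apply_le_of_hasMajorant_blk i b ιB (s • (XinvY i parS O (cfg U₁)).restrictScalars ℝ) hM₂ hrepr hmaj lam s₀ zero_le_one hsupp hbd t
  rw [LinearMap.smul_apply, Pi.smul_apply, LinearMap.restrictScalars_apply, norm_smul, Real.norm_eq_abs, abs_of_nonneg hs0] at hw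
  exact hw.trans (le_of_eq (by ring))

end Literature.MathematicalPhysics.QuantumFieldTheory.Balaban1983to89.B9Thm39CinvOfEBlock

end
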